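import Literature.Analysis.FluidPDE.TaoCascadeZeroScaleTauOne
import Literature.Analysis.FluidPDE.TaoCascadeCoarseEnergy
import Literature.Analysis.FluidPDE.TaoCascadeRotorAveraging
import HarnessLib

/-!
# Tao's cascade ODE, §6.7 Prop. 6.17 in the `ZeroScale.Setting`, I: the coarse-mode levels (6.168)–(6.171)

T. Tao, *Finite time blowup for an averaged three-dimensional Navier–Stokes equation*,
J. Amer. Math. Soc. **29** (2016), 601–674 = arXiv:1402.0290v3, §6.7, Prop. 6.17 and its proof
((6.168)–(6.173) for the coarse modes `b₋₁, c₋₁`, the modified energy `Ẽ*₋₁`, and "it thus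
suffices to show `∫ a₀ ≳ 1`").

Continuation of `TaoCascadeZeroScaleTauOne.lean` (packaging `ZeroScale.Setting`; `t_c`,
`τ₁ = τone = min(t_c + K^{-1/2}, T)`, rotor-phase bounds) combined with the generic Prop. 6.17
machinery of `TaoCascadeCoarseEnergy.lean` (`RescaledHypotheses.coarse_energy_bound`,
`integral_lower_of_three_zones`), `TaoCascadeRotorAveraging.lean` (`integral_rotor_le`) and
`TaoCascadeCoarseSecondary.lean` ((6.168)–(6.173)). This file: the coarse-mode levels
on `[0, 3] ∩ [0, T]` when `n₀ < N` — `b₋₁ ≤ (10⁵ + 1)ε`, `|c₋₁| ≤ e^{(3·10⁵+5)K^{10}}ε²`,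
`b₋₁ ≥ 9·10⁻⁶ε`, and `c₋₁ ≥ e^{5·10⁻⁷K^{10}}ε²` for `t ≥ 1/2` — with every constant numeric, using
the regime inequalities (`ε e^{10⁶K^{10}} ≤ 1`, `C₁(1+ε₀)^{-n₀/2} ≤ ε⁴`). Theorems only.

## References

* T. Tao, J. Amer. Math. Soc. 29 (2016), 601–674, arXiv:1402.0290v3, §6.7 Prop. 6.17,
  (6.168)–(6.173). [`Tao2016AveragedNS`]
-/

noncomputable section

open Set MeasureTheory intervalIntegral Filter Topology

namespace Literature.Analysis.FluidPDE

namespace TaoCascade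

namespace ZeroScale

section CoarseLevels

variable {ε₀ K ε C₁ C₂ C₃ C₄ C₅ : ℝ} {n₀ N : ℤ} {τ : ℤ → ℝ} {Y : Fin 4 → ℤ → ℝ → ℝ}
  {F : ℤ → ℝ → ℝ} {T : ℝ}

/-! ## Regime arithmetic -/

/-- **The basic absorption**: `e^{aK^{10}} K^n ε ≤ 1` whenever `a + n ≤ 10⁶` (from
`ε e^{10⁶K^{10}} ≤ 1` and `K^n ≤ e^{nK} ≤ e^{nK^{10}}`). [folklore] -/
theorem Setting.exp_mul_pow_mul_eps_le_one (hs : Setting ε₀ K ε C₁ C₂ C₃ C₄ C₅ n₀ N τ Y F T)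
    {a : ℝ} {n : ℕ} (h : a + n ≤ 10 ^ 6) : Real.exp (a * K ^ 10) * K ^ n * ε ≤ 1 := by
  have hK1 := hs.one_le_K
  have hε := hs.ε_pos
  have hKn : K ^ n ≤ Real.exp (n * K ^ 10) := by
    calc K ^ n ≤ Real.exp (n * K) := pow_le_exp_mul (by linarith) n
      _ ≤ Real.exp (n * K ^ 10) := by
          apply Real.exp_le_exp.2
          have h2 : K ≤ K ^ 10 := le_self_pow₀ hK1 (by norm_num)
          exact mul_le_mul_of_nonneg_left h2 (Nat.cast_nonneg n)
  have h1 : Real.exp (a * K ^ 10) * K ^ n ≤ Real.exp (10 ^ 6 * K ^ 10) := by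
    calc Real.exp (a * K ^ 10) * K ^ n ≤ Real.exp (a * K ^ 10) * Real.exp (n * K ^ 10) :=
          mul_le_mul_of_nonneg_left hKn (Real.exp_pos _).le
      _ = Real.exp ((a + n) * K ^ 10) := by rw [← Real.exp_add]; ring_nf
      _ ≤ Real.exp (10 ^ 6 * K ^ 10) := by
          apply Real.exp_le_exp.2
          exact mul_le_mul_of_nonneg_right h (by positivity)
  calc Real.exp (a * K ^ 10) * K ^ n * ε ≤ Real.exp (10 ^ 6 * K ^ 10) * ε :=
        mul_le_mul_of_nonneg_right h1 hε.le
    _ = ε * Real.exp (10 ^ 6 * K ^ 10) := by ring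
    _ ≤ 1 := hs.ε_exp

/-- `ε ≤ 10⁻⁶`, `ε ≤ 1`. [folklore] -/
theorem Setting.ε_small (hs : Setting ε₀ K ε C₁ C₂ C₃ C₄ C₅ n₀ N τ Y F T) :
    ε ≤ 1 / 10 ^ 6 ∧ ε ≤ 1 := by
  have hεK := hs.ε_le_K100
  have hK6 := hs.K_large
  have hK1 := hs.one_le_K
  have h1 : (K ^ 100)⁻¹ ≤ 1 / 10 ^ 6 := by
    rw [show (1 : ℝ) / 10 ^ 6 = (10 ^ 6)⁻¹ by norm_num]
    apply inv_anti₀ (by norm_num)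
    calc (10 : ℝ) ^ 6 ≤ K := hK6
      _ ≤ K ^ 100 := le_self_pow₀ hK1 (by norm_num)
  exact ⟨hεK.trans h1, (hεK.trans h1).trans (by norm_num)⟩

/-- `K⁻¹⁰ ≤ 10⁻⁶`. [folklore] -/
theorem Setting.inv_K10_le (hs : Setting ε₀ K ε C₁ C₂ C₃ C₄ C₅ n₀ N τ Y F T) :
    (K ^ 10)⁻¹ ≤ 1 / 10 ^ 6 := by
  have h6 := hs.K_large
  have hK1 := hs.one_le_K
  rw [show (1 : ℝ) / 10 ^ 6 = (10 ^ 6)⁻¹ by norm_num]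
  apply inv_anti₀ (by norm_num)
  calc (10 : ℝ) ^ 6 ≤ K := h6
    _ ≤ K ^ 10 := le_self_pow₀ hK1 (by norm_num)

/-- The coarse error level `C₁(1+ε₀)^{-2-n₀/2}√(2K⁻¹⁰) ≤ ε⁴`. [cite: Tao2016AveragedNS, §6.7] -/
theorem Setting.etam_le (hs : Setting ε₀ K ε C₁ C₂ C₃ C₄ C₅ n₀ N τ Y F T) :
    C₁ * (1 + ε₀) ^ (-2 - (n₀ : ℝ) / 2) * Real.sqrt (2 * (K ^ 10)⁻¹) ≤ ε ^ 4 := by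
  have hq1 := hs.one_lt_q
  have hC₁ := hs.C₁_nn
  have hρ := hs.ρ_le_ε4
  have h1 : (1 + ε₀) ^ (-2 - (n₀ : ℝ) / 2) ≤ (1 + ε₀) ^ (-(n₀ : ℝ) / 2) :=
    Real.rpow_le_rpow_of_exponent_le hq1.le (by linarith)
  have h2 : Real.sqrt (2 * (K ^ 10)⁻¹) ≤ 1 := by
    rw [Real.sqrt_le_one]
    have := hs.inv_K_pow_le_half (n := 10) (by norm_num)
    linarith
  have h3 : 0 ≤ C₁ * (1 + ε₀) ^ (-2 - (n₀ : ℝ) / 2) := by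
    have := hs.q_pos; positivity
  calc C₁ * (1 + ε₀) ^ (-2 - (n₀ : ℝ) / 2) * Real.sqrt (2 * (K ^ 10)⁻¹)
      ≤ C₁ * (1 + ε₀) ^ (-2 - (n₀ : ℝ) / 2) * 1 := mul_le_mul_of_nonneg_left h2 h3
    _ ≤ C₁ * (1 + ε₀) ^ (-(n₀ : ℝ) / 2) := by
        rw [mul_one]; exact mul_le_mul_of_nonneg_left h1 hC₁
    _ ≤ ε ^ 4 := hρ.1

/-! ## The coarse modes `b₋₁, c₋₁` on `[0, 3]` ((6.168)–(6.173)) -/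

/-- **(6.168): `b₋₁ ≤ (10⁵ + 1)ε`** on `[0, T] ∩ [0, 3]` (for `n₀ < N`).
[cite: Tao2016AveragedNS, §6.7 (6.168)] -/
theorem Setting.b_negOne_le (hs : Setting ε₀ K ε C₁ C₂ C₃ C₄ C₅ n₀ N τ Y F T) (hN : n₀ < N)
    {t : ℝ} (ht : t ∈ Icc 0 T) (ht3 : t ≤ 3) : Y 1 (-1) t ≤ (10 ^ 5 + 1) * ε := by
  have hτ0 := hs.τ₀_le
  have hε := hs.ε_pos
  have hK := hs.K_pos
  have hreg : ∀ s ∈ Icc 0 t, F (-1) s ≤ 2 * (K ^ 10)⁻¹ := fun s hs' =>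
    hs.F_negOne_le ⟨hs'.1, hs'.2.trans ht.2⟩
  have h1 := hs.hyp.coarse_b_upper hε hs.C₁_nn hs.ε₀_pos hτ0 hreg ⟨ht.1, le_rfl⟩
  have hb0 := hs.hyp.b_prev_le hN
  have hηm := hs.etam_le
  have hq := hs.qm52_le
  have hεs := hs.ε_small
  have hK10 := hs.inv_K_pow_le_half (n := 10) (by norm_num)
  -- the slope is `≤ 4εK⁻¹⁰ + ε⁴ ≤ ε/3`
  have hslope : (1 + ε₀) ^ (-((5 : ℝ) / 2)) * (2 * ε * (2 * (K ^ 10)⁻¹)) +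
      C₁ * (1 + ε₀) ^ (-2 - (n₀ : ℝ) / 2) * Real.sqrt (2 * (K ^ 10)⁻¹) ≤ ε / 3 := by
    have e1 : (1 + ε₀) ^ (-((5 : ℝ) / 2)) = (1 + ε₀) ^ (-(5 : ℝ) / 2) := by norm_num
    rw [e1]
    have h2 : (1 + ε₀) ^ (-(5 : ℝ) / 2) * (2 * ε * (2 * (K ^ 10)⁻¹)) ≤ 1 * (2 * ε * (2 * (K ^ 10)⁻¹)) :=
      mul_le_mul_of_nonneg_right hq (by positivity)
    have h3 : ε ^ 4 ≤ ε * (1 / 10 ^ 6) := by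
      have : ε ^ 3 ≤ 1 / 10 ^ 6 := by
        calc ε ^ 3 ≤ ε ^ 1 := pow_le_pow_of_le_one hε.le hεs.2 (by norm_num)
          _ ≤ 1 / 10 ^ 6 := by rw [pow_one]; exact hεs.1
      calc ε ^ 4 = ε * ε ^ 3 := by ring
        _ ≤ ε * (1 / 10 ^ 6) := mul_le_mul_of_nonneg_left this hε.le
    have hK10' := hs.inv_K10_le
    have h4 := mul_le_mul_of_nonneg_left hK10' (by positivity : 0 ≤ 4 * ε)
    linarith [h2, h3, hηm, h4]
  have hslope0 : 0 ≤ (1 + ε₀) ^ (-((5 : ℝ) / 2)) * (2 * ε * (2 * (K ^ 10)⁻¹)) +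
      C₁ * (1 + ε₀) ^ (-2 - (n₀ : ℝ) / 2) * Real.sqrt (2 * (K ^ 10)⁻¹) := by
    have := hs.q_pos; have := hs.C₁_nn; positivity
  have h5 := mul_le_mul hslope ht3 ht.1 (by positivity)
  linarith [h1, hb0, h5]

/-- **(6.169): `|c₋₁| ≤ e^{(3·10⁵+5)K^{10}}ε²`** on `[0, T] ∩ [0, 3]` (for `n₀ < N`).
[cite: Tao2016AveragedNS, §6.7 (6.169)] -/
theorem Setting.abs_c_negOne_le (hs : Setting ε₀ K ε C₁ C₂ C₃ C₄ C₅ n₀ N τ Y F T) (hN : n₀ < N)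
    {t : ℝ} (ht : t ∈ Icc 0 T) (ht3 : t ≤ 3) :
    |Y 2 (-1) t| ≤ Real.exp ((3 * 10 ^ 5 + 5) * K ^ 10) * ε ^ 2 := by
  have hτ0 := hs.τ₀_le
  have hε := hs.ε_pos
  have hK := hs.K_pos
  have hK1 := hs.one_le_K
  have hreg : ∀ s ∈ Icc 0 t, F (-1) s ≤ 2 * (K ^ 10)⁻¹ := fun s hs' =>
    hs.F_negOne_le ⟨hs'.1, hs'.2.trans ht.2⟩
  have hbb : ∀ s ∈ Icc 0 t, Y 1 (-1) s ≤ (10 ^ 5 + 1) * ε := fun s hs' =>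
    hs.b_negOne_le hN ⟨hs'.1, hs'.2.trans ht.2⟩ (hs'.2.trans ht3)
  have h1 := hs.hyp.coarse_c_abs_le hε hs.C₁_nn hs.ε₀_pos hτ0 (by positivity) (by positivity) hreg hbb
    ⟨ht.1, le_rfl⟩
  rw [intervalIntegral.integral_const, smul_eq_mul, sub_zero] at h1
  have hηm := hs.etam_le
  have hq := hs.qm52_le
  have hq0 := hs.q_pos
  have hεs := hs.ε_small
  -- the exponent
  have hexp : Real.exp ((1 + ε₀) ^ (-((5 : ℝ) / 2)) * (ε⁻¹ * K ^ 10) * ((10 ^ 5 + 1) * ε) * t) ≤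
      Real.exp ((3 * 10 ^ 5 + 3) * K ^ 10) := by
    apply Real.exp_le_exp.2
    have e1 : (1 + ε₀) ^ (-((5 : ℝ) / 2)) * (ε⁻¹ * K ^ 10) * ((10 ^ 5 + 1) * ε) * t =
        (1 + ε₀) ^ (-(5 : ℝ) / 2) * ((10 ^ 5 + 1) * K ^ 10 * t) := by
      have e2 : (1 + ε₀) ^ (-((5 : ℝ) / 2)) = (1 + ε₀) ^ (-(5 : ℝ) / 2) := by norm_num
      rw [e2]; field_simp
    rw [e1]
    have h2 : (1 + ε₀) ^ (-(5 : ℝ) / 2) * ((10 ^ 5 + 1) * K ^ 10 * t) ≤ 1 * ((10 ^ 5 + 1) * K ^ 10 * t) :=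
      mul_le_mul_of_nonneg_right hq (by have := ht.1; positivity)
    have h3 : (10 ^ 5 + 1) * K ^ 10 * t ≤ (10 ^ 5 + 1) * K ^ 10 * 3 :=
      mul_le_mul_of_nonneg_left ht3 (by positivity)
    linarith
  -- the inner factor
  have ht0 : 0 ≤ t := ht.1
  have hc0 : |Y 2 (-1) 0| ≤ Real.exp (K ^ 10) * ε ^ 2 := by
    have hge := hs.hyp.c_prev_ge hN
    have hle := hs.hyp.c_prev_le hN
    have hpos : 0 < Y 2 (-1) 0 := lt_of_lt_of_le (by positivity) hge
    rw [abs_of_pos hpos]; exact hle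
  have hE : Real.exp (-K ^ 10) ≤ 1 := Real.exp_le_one_iff.2 (by nlinarith [pow_pos hK 10])
  have hK10 := hs.inv_K10_le
  have hA : (1 + ε₀) ^ (-((5 : ℝ) / 2)) * (2 * ε ^ 2 * Real.exp (-K ^ 10) * (2 * (K ^ 10)⁻¹)) ≤
      4 * ε ^ 2 * (K ^ 10)⁻¹ := by
    have e2 : (1 + ε₀) ^ (-((5 : ℝ) / 2)) = (1 + ε₀) ^ (-(5 : ℝ) / 2) := by norm_num
    have e3 : 2 * ε ^ 2 * Real.exp (-K ^ 10) * (2 * (K ^ 10)⁻¹) =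
        Real.exp (-K ^ 10) * (4 * ε ^ 2 * (K ^ 10)⁻¹) := by ring
    rw [e2, e3]
    calc (1 + ε₀) ^ (-(5 : ℝ) / 2) * (Real.exp (-K ^ 10) * (4 * ε ^ 2 * (K ^ 10)⁻¹))
        ≤ 1 * (1 * (4 * ε ^ 2 * (K ^ 10)⁻¹)) :=
          mul_le_mul hq (mul_le_mul_of_nonneg_right hE (by positivity)) (by positivity) (by norm_num)
      _ = 4 * ε ^ 2 * (K ^ 10)⁻¹ := by ring
  have hAK : 4 * ε ^ 2 * (K ^ 10)⁻¹ ≤ 4 * ε ^ 2 * (1 / 10 ^ 6) :=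
    mul_le_mul_of_nonneg_left hK10 (by positivity)
  have hε4 : ε ^ 4 ≤ ε ^ 2 * (1 / 10 ^ 6) := by
    have h3 : ε ^ 2 ≤ 1 / 10 ^ 6 := by
      calc ε ^ 2 ≤ ε ^ 1 := pow_le_pow_of_le_one hε.le hεs.2 (by norm_num)
        _ ≤ 1 / 10 ^ 6 := by rw [pow_one]; exact hεs.1
    calc ε ^ 4 = ε ^ 2 * ε ^ 2 := by ring
      _ ≤ ε ^ 2 * (1 / 10 ^ 6) := mul_le_mul_of_nonneg_left h3 (by positivity)
  have hslope : (1 + ε₀) ^ (-((5 : ℝ) / 2)) * (2 * ε ^ 2 * Real.exp (-K ^ 10) * (2 * (K ^ 10)⁻¹)) +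
      C₁ * (1 + ε₀) ^ (-2 - (n₀ : ℝ) / 2) * Real.sqrt (2 * (K ^ 10)⁻¹) ≤ ε ^ 2 / 3 := by
    linarith [hA, hAK, hηm, hε4, sq_nonneg ε]
  have hslope0 : 0 ≤ (1 + ε₀) ^ (-((5 : ℝ) / 2)) * (2 * ε ^ 2 * Real.exp (-K ^ 10) * (2 * (K ^ 10)⁻¹)) +
      C₁ * (1 + ε₀) ^ (-2 - (n₀ : ℝ) / 2) * Real.sqrt (2 * (K ^ 10)⁻¹) := by
    have := hs.C₁_nn; positivity
  have hinner : t * ((1 + ε₀) ^ (-((5 : ℝ) / 2)) * (2 * ε ^ 2 * Real.exp (-K ^ 10) * (2 * (K ^ 10)⁻¹)) +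
      C₁ * (1 + ε₀) ^ (-2 - (n₀ : ℝ) / 2) * Real.sqrt (2 * (K ^ 10)⁻¹)) ≤ ε ^ 2 := by
    have h8 := mul_le_mul ht3 hslope hslope0 (by norm_num)
    linarith [h8]
  -- assemble: `|c₋₁| ≤ e^{(3·10⁵+3)K^{10}} (e^{K^{10}} + 1) ε² ≤ e^{(3·10⁵+5)K^{10}} ε²`
  have hsum : |Y 2 (-1) 0| + t * ((1 + ε₀) ^ (-((5 : ℝ) / 2)) *
      (2 * ε ^ 2 * Real.exp (-K ^ 10) * (2 * (K ^ 10)⁻¹)) +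
      C₁ * (1 + ε₀) ^ (-2 - (n₀ : ℝ) / 2) * Real.sqrt (2 * (K ^ 10)⁻¹)) ≤
      (Real.exp (K ^ 10) + 1) * ε ^ 2 := by linarith [hc0, hinner]
  have hsum0 : 0 ≤ |Y 2 (-1) 0| + t * ((1 + ε₀) ^ (-((5 : ℝ) / 2)) *
      (2 * ε ^ 2 * Real.exp (-K ^ 10) * (2 * (K ^ 10)⁻¹)) +
      C₁ * (1 + ε₀) ^ (-2 - (n₀ : ℝ) / 2) * Real.sqrt (2 * (K ^ 10)⁻¹)) := by positivity
  have hfin : Real.exp ((3 * 10 ^ 5 + 3) * K ^ 10) * ((Real.exp (K ^ 10) + 1) * ε ^ 2) ≤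
      Real.exp ((3 * 10 ^ 5 + 5) * K ^ 10) * ε ^ 2 := by
    have h2 : Real.exp (K ^ 10) + 1 ≤ Real.exp (2 * K ^ 10) := by
      have h3 : (2 : ℝ) ≤ Real.exp (K ^ 10) := by
        have := Real.add_one_le_exp (K ^ 10)
        have hK10 : (1 : ℝ) ≤ K ^ 10 := one_le_pow₀ hK1
        linarith
      have h4 : Real.exp (2 * K ^ 10) = Real.exp (K ^ 10) * Real.exp (K ^ 10) := by
        rw [← Real.exp_add]; ring_nf
      rw [h4]; nlinarith [h3]
    calc Real.exp ((3 * 10 ^ 5 + 3) * K ^ 10) * ((Real.exp (K ^ 10) + 1) * ε ^ 2)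
        ≤ Real.exp ((3 * 10 ^ 5 + 3) * K ^ 10) * (Real.exp (2 * K ^ 10) * ε ^ 2) := by
          apply mul_le_mul_of_nonneg_left _ (Real.exp_pos _).le
          exact mul_le_mul_of_nonneg_right h2 (by positivity)
      _ = Real.exp ((3 * 10 ^ 5 + 5) * K ^ 10) * ε ^ 2 := by
          rw [← mul_assoc, ← Real.exp_add]; ring_nf
  calc |Y 2 (-1) t| ≤ _ := h1
    _ ≤ Real.exp ((3 * 10 ^ 5 + 3) * K ^ 10) * ((Real.exp (K ^ 10) + 1) * ε ^ 2) :=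
        mul_le_mul hexp hsum hsum0 (Real.exp_pos _).le
    _ ≤ Real.exp ((3 * 10 ^ 5 + 5) * K ^ 10) * ε ^ 2 := hfin

/-- `ε ≤ 10⁻¹²`. [folklore] -/
theorem Setting.ε_le_inv_ten_pow_twelve (hs : Setting ε₀ K ε C₁ C₂ C₃ C₄ C₅ n₀ N τ Y F T) :
    ε ≤ 1 / 10 ^ 12 := by
  have hεK := hs.ε_le_K100
  have hK6 := hs.K_large
  have hK1 := hs.one_le_K
  have h1 : (K ^ 100)⁻¹ ≤ 1 / 10 ^ 12 := by
    rw [show (1 : ℝ) / 10 ^ 12 = (10 ^ 12)⁻¹ by norm_num]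
    apply inv_anti₀ (by norm_num)
    have h2 : (10 : ℝ) ^ 12 = (10 ^ 6) ^ 2 := by norm_num
    calc (10 : ℝ) ^ 12 = (10 ^ 6) ^ 2 := h2
      _ ≤ K ^ 2 := pow_le_pow_left₀ (by norm_num) hK6 2
      _ ≤ K ^ 100 := pow_le_pow_right₀ hK1 (by norm_num)
  exact hεK.trans h1

/-- **(6.170): `b₋₁ ≥ 9·10⁻⁶ε`** on `[0, T] ∩ [0, 3]` (for `n₀ < N`): the rotor term
`ε⁻¹K^{10}c₋₁² ≤ ε⁻¹K^{10}e^{(6·10⁵+10)K^{10}}ε⁴ ≤ ε²` is negligible.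
[cite: Tao2016AveragedNS, §6.7 (6.170)] -/
theorem Setting.b_negOne_ge (hs : Setting ε₀ K ε C₁ C₂ C₃ C₄ C₅ n₀ N τ Y F T) (hN : n₀ < N)
    {t : ℝ} (ht : t ∈ Icc 0 T) (ht3 : t ≤ 3) : 9 / 10 ^ 6 * ε ≤ Y 1 (-1) t := by
  have hτ0 := hs.τ₀_le
  have hε := hs.ε_pos
  have hK := hs.K_pos
  have ht0 : 0 ≤ t := ht.1
  have hreg : ∀ s ∈ Icc 0 t, F (-1) s ≤ 2 * (K ^ 10)⁻¹ := fun s hs' =>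
    hs.F_negOne_le ⟨hs'.1, hs'.2.trans ht.2⟩
  have hcc : ∀ s ∈ Icc 0 t, |Y 2 (-1) s| ≤ Real.exp ((3 * 10 ^ 5 + 5) * K ^ 10) * ε ^ 2 :=
    fun s hs' => hs.abs_c_negOne_le hN ⟨hs'.1, hs'.2.trans ht.2⟩ (hs'.2.trans ht3)
  have h1 := hs.hyp.coarse_b_lower hε hs.C₁_nn hs.ε₀_pos hτ0 hreg hcc ⟨ht.1, le_rfl⟩
  have hb0 := hs.hyp.b_prev_ge hN
  have hηm := hs.etam_le
  have hq := hs.qm52_le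
  have hq0 := hs.q_pos
  have hε12 := hs.ε_le_inv_ten_pow_twelve
  have hεs := hs.ε_small
  -- the rotor term `≤ ε²`
  have hrot : (1 + ε₀) ^ (-((5 : ℝ) / 2)) * (ε⁻¹ * K ^ 10) *
      (Real.exp ((3 * 10 ^ 5 + 5) * K ^ 10) * ε ^ 2) ^ 2 ≤ ε ^ 2 := by
    have e1 : (1 + ε₀) ^ (-((5 : ℝ) / 2)) = (1 + ε₀) ^ (-(5 : ℝ) / 2) := by norm_num
    have habs := hs.exp_mul_pow_mul_eps_le_one (a := 2 * (3 * 10 ^ 5 + 5)) (n := 10) (by norm_num)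
    have e2 : (ε⁻¹ * K ^ 10) * (Real.exp ((3 * 10 ^ 5 + 5) * K ^ 10) * ε ^ 2) ^ 2 =
        ε ^ 2 * (Real.exp (2 * (3 * 10 ^ 5 + 5) * K ^ 10) * K ^ 10 * ε) := by
      have e3 : (Real.exp ((3 * 10 ^ 5 + 5) * K ^ 10)) ^ 2 = Real.exp (2 * (3 * 10 ^ 5 + 5) * K ^ 10) := by
        rw [← Real.exp_nat_mul]; ring_nf
      rw [mul_pow, e3]
      field_simp
    rw [e1, mul_assoc, e2]
    have h2 : ε ^ 2 * (Real.exp (2 * (3 * 10 ^ 5 + 5) * K ^ 10) * K ^ 10 * ε) ≤ ε ^ 2 * 1 :=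
      mul_le_mul_of_nonneg_left habs (by positivity)
    calc (1 + ε₀) ^ (-(5 : ℝ) / 2) * (ε ^ 2 * (Real.exp (2 * (3 * 10 ^ 5 + 5) * K ^ 10) * K ^ 10 * ε))
        ≤ 1 * (ε ^ 2 * 1) := mul_le_mul hq h2 (by positivity) (by norm_num)
      _ = ε ^ 2 := by ring
  have hε4 : ε ^ 4 ≤ ε ^ 2 := pow_le_pow_of_le_one hε.le hεs.2 (by norm_num)
  have hslope : ((1 + ε₀) ^ (-((5 : ℝ) / 2)) * (ε⁻¹ * K ^ 10) *
      (Real.exp ((3 * 10 ^ 5 + 5) * K ^ 10) * ε ^ 2) ^ 2 +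
      C₁ * (1 + ε₀) ^ (-2 - (n₀ : ℝ) / 2) * Real.sqrt (2 * (K ^ 10)⁻¹)) * t ≤ 1 / 10 ^ 6 * ε := by
    have h2 : (1 + ε₀) ^ (-((5 : ℝ) / 2)) * (ε⁻¹ * K ^ 10) *
        (Real.exp ((3 * 10 ^ 5 + 5) * K ^ 10) * ε ^ 2) ^ 2 +
        C₁ * (1 + ε₀) ^ (-2 - (n₀ : ℝ) / 2) * Real.sqrt (2 * (K ^ 10)⁻¹) ≤ 2 * ε ^ 2 := by
      linarith [hrot, hηm, hε4]
    have h0 : 0 ≤ (1 + ε₀) ^ (-((5 : ℝ) / 2)) * (ε⁻¹ * K ^ 10) *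
        (Real.exp ((3 * 10 ^ 5 + 5) * K ^ 10) * ε ^ 2) ^ 2 +
        C₁ * (1 + ε₀) ^ (-2 - (n₀ : ℝ) / 2) * Real.sqrt (2 * (K ^ 10)⁻¹) := by
      have := hs.C₁_nn; positivity
    have h3 := mul_le_mul h2 ht3 ht0 (by positivity)
    have h4 : ε ^ 2 ≤ 1 / 10 ^ 12 * ε := by
      rw [sq]; exact mul_le_mul_of_nonneg_right hε12 hε.le
    linarith [h3, h4]
  linarith [h1, hb0, hslope]

/-- **(6.171): `c₋₁ ≥ e^{5·10⁻⁷K^{10}}ε²` for `1/2 ≤ t ≤ 3`** (for `n₀ < N`): growth at rate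
`(1+ε₀)^{-5/2}ε⁻¹K^{10}b₋₁ ≥ ⅛·9·10⁻⁶K^{10}` from `c₋₁(0) ≥ e^{K⁹}ε²`.
[cite: Tao2016AveragedNS, §6.7 (6.171)] -/
theorem Setting.c_negOne_ge (hs : Setting ε₀ K ε C₁ C₂ C₃ C₄ C₅ n₀ N τ Y F T) (hN : n₀ < N)
    {t : ℝ} (ht : t ∈ Icc 0 T) (ht3 : t ≤ 3) (ht2 : 1 / 2 ≤ t) :
    Real.exp (5 / 10 ^ 7 * K ^ 10) * ε ^ 2 ≤ Y 2 (-1) t := by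
  have hτ0 := hs.τ₀_le
  have hε := hs.ε_pos
  have hK := hs.K_pos
  have hK1 := hs.one_le_K
  have ht0 : 0 ≤ t := ht.1
  have hreg : ∀ s ∈ Icc 0 t, F (-1) s ≤ 2 * (K ^ 10)⁻¹ := fun s hs' =>
    hs.F_negOne_le ⟨hs'.1, hs'.2.trans ht.2⟩
  have hbb : ∀ s ∈ Icc 0 t, 9 / 10 ^ 6 * ε ≤ Y 1 (-1) s := fun s hs' =>
    hs.b_negOne_ge hN ⟨hs'.1, hs'.2.trans ht.2⟩ (hs'.2.trans ht3)
  have hηm := hs.etam_le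
  have hεs := hs.ε_small
  have hc0 := hs.hyp.c_prev_ge hN
  have hK9 : (2 : ℝ) ≤ Real.exp (K ^ 9) := by
    have := Real.add_one_le_exp (K ^ 9)
    have h9 : (1 : ℝ) ≤ K ^ 9 := one_le_pow₀ hK1
    linarith
  have hε4 : 3 * ε ^ 4 ≤ ε ^ 2 := by
    have h3 : ε ^ 2 ≤ 1 / 3 := by nlinarith [hεs.1, hε.le]
    nlinarith [h3, sq_nonneg ε]
  have hinit : C₁ * (1 + ε₀) ^ (-2 - (n₀ : ℝ) / 2) * Real.sqrt (2 * (K ^ 10)⁻¹) * (t - 0) ≤ Y 2 (-1) 0 := by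
    rw [sub_zero]
    have h0 : 0 ≤ C₁ * (1 + ε₀) ^ (-2 - (n₀ : ℝ) / 2) * Real.sqrt (2 * (K ^ 10)⁻¹) := by
      have := hs.C₁_nn; have := hs.q_pos; positivity
    have h2 := mul_le_mul hηm ht3 ht0 (by positivity)
    nlinarith [h2, hK9, hε4, hc0, sq_nonneg ε]
  have h1 := hs.hyp.coarse_c_lower hε hs.C₁_nn hs.ε₀_pos hτ0 (by positivity) hreg hbb ⟨ht.1, le_rfl⟩ hinit
  rw [sub_zero] at h1
  have hq := hs.qm52_ge
  -- the exponent is `≥ 5·10⁻⁷ K^{10}`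
  have hexp : Real.exp (5 / 10 ^ 7 * K ^ 10) ≤
      Real.exp ((1 + ε₀) ^ (-((5 : ℝ) / 2)) * (ε⁻¹ * K ^ 10) * (9 / 10 ^ 6 * ε) * t) := by
    apply Real.exp_le_exp.2
    have e1 : (1 + ε₀) ^ (-((5 : ℝ) / 2)) = (1 + ε₀) ^ (-(5 : ℝ) / 2) := by norm_num
    have e2 : (1 + ε₀) ^ (-((5 : ℝ) / 2)) * (ε⁻¹ * K ^ 10) * (9 / 10 ^ 6 * ε) * t =
        (1 + ε₀) ^ (-(5 : ℝ) / 2) * (9 / 10 ^ 6 * K ^ 10 * t) := by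
      rw [e1]; field_simp
    rw [e2]
    have h2 : 1 / 8 * (9 / 10 ^ 6 * K ^ 10 * t) ≤ (1 + ε₀) ^ (-(5 : ℝ) / 2) * (9 / 10 ^ 6 * K ^ 10 * t) :=
      mul_le_mul_of_nonneg_right hq (by positivity)
    have h3 : 9 / 10 ^ 6 * K ^ 10 * (1 / 2) ≤ 9 / 10 ^ 6 * K ^ 10 * t :=
      mul_le_mul_of_nonneg_left ht2 (by positivity)
    nlinarith [h2, h3, pow_pos hK 10]
  -- the inner factor is `≥ ε²`
  have hinner : ε ^ 2 ≤ Y 2 (-1) 0 - C₁ * (1 + ε₀) ^ (-2 - (n₀ : ℝ) / 2) * Real.sqrt (2 * (K ^ 10)⁻¹) * t := by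
    have h0 : 0 ≤ C₁ * (1 + ε₀) ^ (-2 - (n₀ : ℝ) / 2) * Real.sqrt (2 * (K ^ 10)⁻¹) := by
      have := hs.C₁_nn; have := hs.q_pos; positivity
    have h2 := mul_le_mul hηm ht3 ht0 (by positivity)
    nlinarith [h2, hK9, hε4, hc0, sq_nonneg ε]
  calc Real.exp (5 / 10 ^ 7 * K ^ 10) * ε ^ 2
      ≤ Real.exp ((1 + ε₀) ^ (-((5 : ℝ) / 2)) * (ε⁻¹ * K ^ 10) * (9 / 10 ^ 6 * ε) * t) *
          (Y 2 (-1) 0 - C₁ * (1 + ε₀) ^ (-2 - (n₀ : ℝ) / 2) * Real.sqrt (2 * (K ^ 10)⁻¹) * t) :=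
        mul_le_mul hexp hinner (by positivity) (Real.exp_pos _).le
    _ ≤ Y 2 (-1) t := h1

end CoarseLevels

end ZeroScale

end TaoCascade

end Literature.Analysis.FluidPDE
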